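import Mathlib
import Summits.Ventures.PercRepro2.K5StarCertDefs

/-!
# THE `pB + M(T, e*)` CERTIFICATES OF THE CRUX KERNEL, II: the coincidence markings (blind cell PercRepro2, p2 g2, 2026-08-25; one `decide +kernel` per statement; Python twin
mining/p2/g2/star_tvt.py / star_groups_ms.py)
-/

namespace Summit.Ventures.PercRepro2

namespace K5

set_option maxHeartbeats 0 in
set_option maxRecDepth 100000 in
/-- `pB + M(K₅, T, e*) ≥ 0` at the marking `(0, 1, 2, 3, 3)`, `T = {0, 1, 3}`, `e* = {0, 1}`. -/
theorem cert_K3B_b3_013_01 :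
    CertLE (sumB (negOn3b 3) (pairMask 0 1) (pairMask 0 3) (pairMask 1 3) +
        sumM (negOn3b 3) (triMask 0 1 3) (pairMask 0 1))
      (sumB (posOn3b 3) (pairMask 0 1) (pairMask 0 3) (pairMask 1 3) +
        sumM (posOn3b 3) (triMask 0 1 3) (pairMask 0 1)) := by
  unfold CertLE
  decide +kernel

set_option maxHeartbeats 0 in
set_option maxRecDepth 100000 in
/-- `pB + M(K₅, T, e*) ≥ 0` at the marking `(0, 1, 2, 3, 3)`, `T = {0, 2, 3}`, `e* = {0, 2}`. -/
theorem cert_K3B_b3_023_02 :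
    CertLE (sumB (negOn3b 3) (pairMask 0 2) (pairMask 0 3) (pairMask 2 3) +
        sumM (negOn3b 3) (triMask 0 2 3) (pairMask 0 2))
      (sumB (posOn3b 3) (pairMask 0 2) (pairMask 0 3) (pairMask 2 3) +
        sumM (posOn3b 3) (triMask 0 2 3) (pairMask 0 2)) := by
  unfold CertLE
  decide +kernel

set_option maxHeartbeats 0 in
set_option maxRecDepth 100000 in
/-- `pB + M(K₅, T, e*) ≥ 0` at the marking `(0, 1, 2, 3, 0)`, `T = {0, 1, 3}`, `e* = {0, 1}`. -/
theorem cert_K3B_b0_013_01 :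
    CertLE (sumB (negOn3b 0) (pairMask 0 1) (pairMask 0 3) (pairMask 1 3) +
        sumM (negOn3b 0) (triMask 0 1 3) (pairMask 0 1))
      (sumB (posOn3b 0) (pairMask 0 1) (pairMask 0 3) (pairMask 1 3) +
        sumM (posOn3b 0) (triMask 0 1 3) (pairMask 0 1)) := by
  unfold CertLE
  decide +kernel

set_option maxHeartbeats 0 in
set_option maxRecDepth 100000 in
/-- `pB + M(K₅, T, e*) ≥ 0` at the marking `(0, 1, 2, 3, 0)`, `T = {0, 2, 3}`, `e* = {0, 2}`. -/
theorem cert_K3B_b0_023_02 :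
    CertLE (sumB (negOn3b 0) (pairMask 0 2) (pairMask 0 3) (pairMask 2 3) +
        sumM (negOn3b 0) (triMask 0 2 3) (pairMask 0 2))
      (sumB (posOn3b 0) (pairMask 0 2) (pairMask 0 3) (pairMask 2 3) +
        sumM (posOn3b 0) (triMask 0 2 3) (pairMask 0 2)) := by
  unfold CertLE
  decide +kernel

end K5

end Summit.Ventures.PercRepro2
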